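import Summits.HodgeConjecture.HodgeConjecture.Theses.DeltaPeriodAudit
import Summits.HodgeConjecture.HodgeConjecture.Cruxes.HodgeForcesNewformPeriodRatioIrrational.Lines.birth
import Literature.NumberTheory.EllipticCurves.NewformOpenImageGaloisProofs

/-!
# Strategist sketch — `DeltaPeriodRatioIrrational` (stmt-HodgeConjecture-2363)

Typed content of `STRATEGY-CENSUS.md` (crux-strategist seat `cstrat-stmt-HodgeConjecture-2363-s2`):
the four switches (Transfer / Strengthen / Decomposition / Negation) written as Lean signatures over
existing declarations, with the cheap implications PROVED, so that the census can point at exactly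
which piece remains the whole crux.  Nothing here is registered as a line: every candidate hard stub
is equivalent to the crux modulo proved / routine bookkeeping (see the `_iff_` remarks), which is
the definition of costume.

The crux, verbatim (route `DeltaPeriodAudit`, item 2363):
`Irrational ((s₅(Δ) / s₆(Δ)) ^ 2)` with `s_j(Δ) = ∫₀^∞ tʲ Re Δ(it) dt = j! (2π)^{-(j+1)} L(Δ, j+1)`.
-/

noncomputable section

namespace Summit.HodgeConjecture.HodgeConjecture.Cruxes.DeltaPeriodRatioIrrational.Strategist

open scoped TensorProduct
open Literature.AlgebraicGeometry.Motives
open Literature.NumberTheory.EllipticCurves.ModularForms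
open Literature.NumberTheory.GaloisRepresentations
open Summit.HodgeConjecture.HodgeConjecture.Theses.DeltaPeriodAudit
open Summit.HodgeConjecture.HodgeConjecture.Cruxes.HodgeForcesNewformPeriodRatioIrrational.Birth
  (compress transport GaloisEquivariantOnOpen im_apply_imagAxis_eq_zero_of_isNewform0)

/-- `s_j(Δ) = ∫₀^∞ tʲ Re Δ(it) dt` (the imaginary-axis Mellin period of Mathlib's discriminant form). -/
def deltaPeriod (j : ℕ) : ℝ :=
  ∫ t in Set.Ioi (0:ℝ), t ^ j * (ModularForm.discriminant (UpperHalfPlane.ofComplex ((t : ℂ) * Complex.I))).re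

/-- The crux is literally `Irrational ((s₅/s₆)²)`. -/
theorem crux_iff : DeltaPeriodRatioIrrational ↔ Irrational ((deltaPeriod 5 / deltaPeriod 6) ^ 2) :=
  Iff.rfl

/-! ## Transfer — T3 (Tate side): the Galois analogue of the crux is a THEOREM of the tree.
`End_{Γ_ℚ}(V_ℓ(Δ)) = ℚ_ℓ` follows from open image; the bridge Galois ⟹ Hodge is the missing
inclusion `G_ℓ° ⊂ MT(M_Δ) ⊗ ℚ_ℓ` (typed below as `DeligneInclusionDelta`). -/
example : momose_isOpen_range_galoisRep := momose_isOpen_range_galoisRep_holds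

/-! ## Strengthen -/

/-- S⁺₁: transcendence of the cross-parity ratio (Kohnen's 1989 conjecture in weight 12 over `ℚ̄`). -/
def RatioTranscendental : Prop := Transcendental ℚ (deltaPeriod 5 / deltaPeriod 6)

/-- S⁺₁ ⟹ crux (routine). -/
theorem crux_of_ratioTranscendental : RatioTranscendental → DeltaPeriodRatioIrrational :=
  fun h => (h.pow two_pos).irrational

/-- Δ packaged as the rational, non-CM, level-1 newform of weight 12 (bookkeeping piece of D1 and of
S⁺₂): some `f : S₁₂(Γ₀(1))` agreeing with `ModularForm.discriminant` pointwise is Atkin–Lehner new,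
has `coeffField = ⊥` and no CM character (on paper: `dim S₁₂ = 1`, `τ(n) ∈ ℤ`, and
`τ(p) ≡ 1 + p¹¹ (mod 691)` gives `τ(p) ≠ 0` for `p ≢ -1 (mod 691)`, while a CM form has `a_p = 0` on
a set of primes of density `1/2`). Unformalised; routine but long. -/
def DeltaPackaging : Prop :=
  ∃ f : CuspForm (CongruenceSubgroup.Gamma0 1) 12,
    (∀ z : UpperHalfPlane, f z = ModularForm.discriminant z) ∧ IsNewform0 f ∧ coeffField f = ⊥ ∧
    ¬ ∃ (M : ℕ) (η : DirichletCharacter ℂ M), η ≠ 1 ∧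
        ∀ᶠ p : ℕ in Filter.cofinite, p.Prime → η (p : ZMod M) * heckeEigenvalue f p = heckeEigenvalue f p

/-- S⁺₂: the uniform strengthening — no rational non-CM newform of weight ≥ 3 has a rational
cross-parity period ratio squared (the negation of the route's bet `RationalNewformPeriodRatio`). -/
def UniformIrrationality : Prop := ¬ RationalNewformPeriodRatio

/-- S⁺₂ ⟹ crux, modulo Δ-packaging and `s₅ s₆ ≠ 0` (the latter from the proved support item
`DeltaImagAxisPos` plus integrability). -/
theorem crux_of_uniformIrrationality (hΔ : DeltaPackaging) (h5 : deltaPeriod 5 ≠ 0)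
    (h6 : deltaPeriod 6 ≠ 0) (hU : UniformIrrationality) : DeltaPeriodRatioIrrational := by
  obtain ⟨f, hfΔ, hnew, hQ, hCM⟩ := hΔ
  by_contra hirr
  have hx : ((deltaPeriod 5 / deltaPeriod 6) ^ 2 : ℝ) ∈ Set.range ((↑) : ℚ → ℝ) := by
    simpa [Irrational, crux_iff] using hirr
  obtain ⟨q, hq⟩ := hx
  have h5' : (∫ t in Set.Ioi (0:ℝ), t ^ 5 * (f (UpperHalfPlane.ofComplex ((t : ℂ) * Complex.I))).re) =
      deltaPeriod 5 := by simp only [deltaPeriod, hfΔ]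
  have h6' : (∫ t in Set.Ioi (0:ℝ), t ^ 6 * (f (UpperHalfPlane.ofComplex ((t : ℂ) * Complex.I))).re) =
      deltaPeriod 6 := by simp only [deltaPeriod, hfΔ]
  refine hU ⟨1, inferInstance, 12, f, 5, 6, q, by norm_num, hnew, hQ, hCM, by norm_num, by norm_num,
    by decide, ?_, ?_, ?_⟩
  · rw [h5']; exact h5
  · rw [h6']; exact h6
  · rw [h5', h6']; exact hq.symm

/-! ## Decomposition — D1, the Deligne-chain cut of the crux at Δ (the only typed split found).
Pieces: `DeligneInclusionDelta` (hard) + birth stub B of item 2365 (provable, open image) + birth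
stub C of item 2365 (provable, period dictionary) + `DeltaPackaging` + `s₅ s₆ ≠ 0`. -/

/-- D1.1 — THE HARD PIECE (= the Mumford–Tate inclusion `G_ℓ° ⊂ MT ⊗ ℚ_ℓ` for Scholl's motive
`M_Δ`, ℓ = 2; = "Hodge classes in `M_Δ ⊗ M_Δ^∨ ⊂ H²²(W × W)(11)` are Tate"): Scholl's datum of Δ
carries a Galois representation attached to Δ and a comparison framing such that EVERY endomorphism
of the Hodge structure, compressed to `V_Δ`, is Galois-equivariant on an open subgroup —
unconditionally (birth stub A of item 2365 asserts this only under `HodgeConjecture`). -/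
def DeligneInclusionDelta : Prop :=
  ∀ f : CuspForm (CongruenceSubgroup.Gamma0 1) 12,
    (∀ z : UpperHalfPlane, f z = ModularForm.discriminant z) → IsNewform0 f → coeffField f = ⊥ →
    ∃ (D : SchollBettiRealisation f) (ι : coeffCharField (liftToGamma1 1 12 f) →+* ℚ_[2])
      (ρ : FramedGaloisRep ℚ ℚ_[2] 2) (θ : ℚ_[2] ⊗[ℚ] D.carrier ≃ₗ[ℚ_[2]] (Fin 2 → ℚ_[2])),
      IsGaloisRepOfNewform1 (liftToGamma1 1 12 f) ι {p | p ∣ 1 * 2} ρ ∧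
      ∀ A : HodgeStructure.Hom D.hodge D.hodge,
        GaloisEquivariantOnOpen ρ (transport θ (compress D A.toLinearMap))

/-- D1.2 — birth stub B of item 2365 (open image ⟹ rational scalar commutant; provable now from
`momose_isOpen_range_galoisRep_holds`). Copied verbatim so that the split is typed over it. -/
def RationalScalarOfGaloisCommutant : Prop :=
  ∀ (N : ℕ) [NeZero N] (k : ℤ) (f : CuspForm (CongruenceSubgroup.Gamma0 N) k),
    2 ≤ k → IsNewform0 f → coeffField f = ⊥ →
    (¬ ∃ (M : ℕ) (η : DirichletCharacter ℂ M), η ≠ 1 ∧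
        ∀ᶠ p : ℕ in Filter.cofinite, p.Prime →
          η (p : ZMod M) * heckeEigenvalue f p = heckeEigenvalue f p) →
    ∀ (ℓ : ℕ) [Fact ℓ.Prime] (ι : coeffCharField (liftToGamma1 N k f) →+* ℚ_[ℓ])
      (ρ : FramedGaloisRep ℚ ℚ_[ℓ] 2),
      IsGaloisRepOfNewform1 (liftToGamma1 N k f) ι {p | p ∣ N * ℓ} ρ →
      ∀ (V : Type) [AddCommGroup V] [Module ℚ V]
        (θ : ℚ_[ℓ] ⊗[ℚ] V ≃ₗ[ℚ_[ℓ]] (Fin 2 → ℚ_[ℓ])) (B : V →ₗ[ℚ] V),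
        GaloisEquivariantOnOpen ρ (transport θ B) → ∃ c : ℚ, B = c • LinearMap.id

/-- D1.3 — birth stub C of item 2365 (scalar Hodge commutant on `V_f` ⟹ `(s_a/s_b)² ∉ ℚ`;
provable now from the fields of `SchollBettiRealisation`). Copied verbatim. -/
def PeriodRatioSqIrrationalOfHodgeEndScalar : Prop :=
  ∀ (N : ℕ) [NeZero N] (k : ℤ) (f : CuspForm (CongruenceSubgroup.Gamma0 N) k)
    (D : SchollBettiRealisation f),
    coeffField f = ⊥ →
    (∀ t : ℝ, 0 < t → (f (UpperHalfPlane.ofComplex ((t : ℂ) * Complex.I))).im = 0) →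
    (∀ A : HodgeStructure.Hom D.hodge D.hodge, ∃ c : ℚ, compress D A.toLinearMap = c • LinearMap.id) →
    ∀ a b : ℕ, (a : ℤ) + 2 ≤ k → (b : ℤ) + 2 ≤ k → Odd (a + b) →
      (∫ t in Set.Ioi (0:ℝ), t ^ a * (f (UpperHalfPlane.ofComplex ((t : ℂ) * Complex.I))).re) ≠ 0 →
      (∫ t in Set.Ioi (0:ℝ), t ^ b * (f (UpperHalfPlane.ofComplex ((t : ℂ) * Complex.I))).re) ≠ 0 →
      Irrational (((∫ t in Set.Ioi (0:ℝ), t ^ a * (f (UpperHalfPlane.ofComplex ((t : ℂ) * Complex.I))).re) /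
        (∫ t in Set.Ioi (0:ℝ), t ^ b * (f (UpperHalfPlane.ofComplex ((t : ℂ) * Complex.I))).re)) ^ 2)

/-- **D1, kernel-checked**: hard piece + stub B + stub C + Δ-packaging + non-vanishing ⟹ the crux BY
NAME.  (This is what `route edit --split` would need landed; it is NOT filed, because D1.1 is the
crux again modulo D1.2–D1.4: see the census.) -/
theorem crux_of_D1 (hIncl : DeligneInclusionDelta) (hB : RationalScalarOfGaloisCommutant)
    (hC : PeriodRatioSqIrrationalOfHodgeEndScalar) (hΔ : DeltaPackaging)
    (h5 : deltaPeriod 5 ≠ 0) (h6 : deltaPeriod 6 ≠ 0) : DeltaPeriodRatioIrrational := by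
  obtain ⟨f, hfΔ, hnew, hQ, hCM⟩ := hΔ
  obtain ⟨D, ι, ρ, θ, hρ, hgal⟩ := hIncl f hfΔ hnew hQ
  have hscalar : ∀ A : HodgeStructure.Hom D.hodge D.hodge,
      ∃ c : ℚ, compress D A.toLinearMap = c • LinearMap.id := fun A =>
    hB 1 12 f (by norm_num) hnew hQ hCM 2 ι ρ hρ D.carrier θ (compress D A.toLinearMap) (hgal A)
  have h5' : (∫ t in Set.Ioi (0:ℝ), t ^ 5 * (f (UpperHalfPlane.ofComplex ((t : ℂ) * Complex.I))).re) =
      deltaPeriod 5 := by simp only [deltaPeriod, hfΔ]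
  have h6' : (∫ t in Set.Ioi (0:ℝ), t ^ 6 * (f (UpperHalfPlane.ofComplex ((t : ℂ) * Complex.I))).re) =
      deltaPeriod 6 := by simp only [deltaPeriod, hfΔ]
  have key := hC 1 12 f D hQ (im_apply_imagAxis_eq_zero_of_isNewform0 hnew) hscalar 5 6
    (by norm_num) (by norm_num) (by decide) (by rw [h5']; exact h5) (by rw [h6']; exact h6)
  rw [h5', h6'] at key
  exact key

/-- The HC-free half of birth stub A at Δ (Scholl 1990, Thm. 1.2.4; unconditional on paper):
Scholl's Betti datum of Δ with a 2-adic representation attached to Δ and an Artin-comparison framing. -/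
def SchollDatumDelta : Prop :=
  ∀ f : CuspForm (CongruenceSubgroup.Gamma0 1) 12,
    (∀ z : UpperHalfPlane, f z = ModularForm.discriminant z) → IsNewform0 f → coeffField f = ⊥ →
    ∃ (D : SchollBettiRealisation f) (ι : coeffCharField (liftToGamma1 1 12 f) →+* ℚ_[2])
      (ρ : FramedGaloisRep ℚ ℚ_[2] 2) (θ : ℚ_[2] ⊗[ℚ] D.carrier ≃ₗ[ℚ_[2]] (Fin 2 → ℚ_[2])),
      IsGaloisRepOfNewform1 (liftToGamma1 1 12 f) ι {p | p ∣ 1 * 2} ρ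

/-- The converse period dictionary (forward direction of the proved `EigenlineCMCriterion` on
`V_f`; provable now from the fields of `SchollBettiRealisation`, like stub C): an irrational
`(s_a/s_b)²` forces every Hodge endomorphism to compress to a rational scalar. -/
def HodgeEndScalarOfIrrational : Prop :=
  ∀ (N : ℕ) [NeZero N] (k : ℤ) (f : CuspForm (CongruenceSubgroup.Gamma0 N) k)
    (D : SchollBettiRealisation f),
    coeffField f = ⊥ →
    (∀ t : ℝ, 0 < t → (f (UpperHalfPlane.ofComplex ((t : ℂ) * Complex.I))).im = 0) →
    ∀ a b : ℕ, (a : ℤ) + 2 ≤ k → (b : ℤ) + 2 ≤ k → Odd (a + b) →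
      Irrational (((∫ t in Set.Ioi (0:ℝ), t ^ a * (f (UpperHalfPlane.ofComplex ((t : ℂ) * Complex.I))).re) /
        (∫ t in Set.Ioi (0:ℝ), t ^ b * (f (UpperHalfPlane.ofComplex ((t : ℂ) * Complex.I))).re)) ^ 2) →
      ∀ A : HodgeStructure.Hom D.hodge D.hodge, ∃ c : ℚ, compress D A.toLinearMap = c • LinearMap.id

/-- **Why D1 is not filed**: modulo the HC-free Scholl datum and the (provable) converse dictionary,
the crux already implies the hard piece D1.1 — so D1.1 ⟺ crux given bookkeeping, i.e. the split
hides the whole crux in one piece (costume).  Kernel-checked. -/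
theorem D1_hard_of_crux (hS : SchollDatumDelta) (hconv : HodgeEndScalarOfIrrational)
    (hcrux : DeltaPeriodRatioIrrational) : DeligneInclusionDelta := by
  intro f hfΔ hnew hQ
  obtain ⟨D, ι, ρ, θ, hρ⟩ := hS f hfΔ hnew hQ
  refine ⟨D, ι, ρ, θ, hρ, fun A => ?_⟩
  have h5' : (∫ t in Set.Ioi (0:ℝ), t ^ 5 * (f (UpperHalfPlane.ofComplex ((t : ℂ) * Complex.I))).re) =
      deltaPeriod 5 := by simp only [deltaPeriod, hfΔ]
  have h6' : (∫ t in Set.Ioi (0:ℝ), t ^ 6 * (f (UpperHalfPlane.ofComplex ((t : ℂ) * Complex.I))).re) =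
      deltaPeriod 6 := by simp only [deltaPeriod, hfΔ]
  have hirr : Irrational (((∫ t in Set.Ioi (0:ℝ), t ^ 5 * (f (UpperHalfPlane.ofComplex ((t : ℂ) * Complex.I))).re) /
      (∫ t in Set.Ioi (0:ℝ), t ^ 6 * (f (UpperHalfPlane.ofComplex ((t : ℂ) * Complex.I))).re)) ^ 2) := by
    rw [h5', h6']; exact hcrux
  obtain ⟨c, hc⟩ := hconv 1 12 f D hQ (im_apply_imagAxis_eq_zero_of_isNewform0 hnew) 5 6
    (by norm_num) (by norm_num) (by decide) hirr A
  have ht : transport θ (compress D A.toLinearMap) = (c : ℚ_[2]) • LinearMap.id := by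
    rw [hc, transport, LinearMap.baseChange_smul, LinearMap.baseChange_id]
    apply LinearMap.ext
    intro x
    simp only [LinearMap.coe_comp, LinearEquiv.coe_coe, Function.comp_apply, LinearMap.smul_apply,
      LinearMap.id_apply]
    rw [← algebraMap_smul ℚ_[2] c (θ.symm x), map_smul, LinearEquiv.apply_symm_apply, eq_ratCast]
  refine ⟨⊤, fun g _ => ?_⟩
  rw [ht, LinearMap.comp_smul, LinearMap.smul_comp, LinearMap.comp_id, LinearMap.id_comp]

/-! ## Negation — the counterexample form. `¬ crux` says `(s₅/s₆)² = q ∈ ℚ`, i.e. the rank-2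
lattice `Λ_Δ = ℤ s₆ ⊕ ℤ i s₅` (equivalently `V_Δ` with its Hodge line of slope `i s₅/s₆`, by the
proved `EigenlineCMCriterion`) has complex multiplication by `ℚ(√-q)`. -/

/-- N1: the negation as an existential over `ℚ` (what a counterexample must exhibit exactly). -/
def RationalRatioSq : Prop := ∃ q : ℚ, (deltaPeriod 5 / deltaPeriod 6) ^ 2 = (q : ℝ)

theorem not_crux_iff : ¬ DeltaPeriodRatioIrrational ↔ RationalRatioSq := by
  constructor
  · intro h
    have hx : ((deltaPeriod 5 / deltaPeriod 6) ^ 2 : ℝ) ∈ Set.range ((↑) : ℚ → ℝ) := by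
      simpa [Irrational, crux_iff] using h
    obtain ⟨q, hq⟩ := hx
    exact ⟨q, hq.symm⟩
  · rintro ⟨q, hq⟩ h
    exact h ⟨q, hq.symm⟩

/-- N1 read through the proved support item: a rational `(s₅/s₆)²` is exactly a non-scalar rational
matrix preserving the Hodge line of slope `τ = i s₅/s₆` (CM of the lattice), since `τ² = -(s₅/s₆)²`. -/
theorem rationalRatioSq_iff_eigenlineCM (hE : EigenlineCMCriterion) (h6 : deltaPeriod 6 ≠ 0)
    (h5 : deltaPeriod 5 ≠ 0) :
    RationalRatioSq ↔
      ∃ A : Matrix (Fin 2) (Fin 2) ℚ, (∀ c : ℚ, A ≠ c • (1 : Matrix (Fin 2) (Fin 2) ℚ)) ∧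
        ∃ μ : ℂ, (A.map (fun x : ℚ => (x : ℂ))).mulVec ![((deltaPeriod 5 / deltaPeriod 6 : ℝ) : ℂ) * Complex.I, 1]
          = μ • ![((deltaPeriod 5 / deltaPeriod 6 : ℝ) : ℂ) * Complex.I, 1] := by
  have hτ := hE (((deltaPeriod 5 / deltaPeriod 6 : ℝ) : ℂ) * Complex.I)
    (by simp [Complex.mul_re])
    (by
      have : (deltaPeriod 5 / deltaPeriod 6 : ℝ) ≠ 0 := div_ne_zero h5 h6
      simpa [Complex.mul_im] using this)
  rw [hτ]
  constructor
  · rintro ⟨q, hq⟩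
    refine ⟨-q, ?_⟩
    have : (((deltaPeriod 5 / deltaPeriod 6 : ℝ) : ℂ) * Complex.I) ^ 2 =
        -(((deltaPeriod 5 / deltaPeriod 6) ^ 2 : ℝ) : ℂ) := by
      push_cast; rw [mul_pow, Complex.I_sq]; ring
    rw [this, hq]; push_cast; ring
  · rintro ⟨q, hq⟩
    refine ⟨-q, ?_⟩
    have h2 : (((deltaPeriod 5 / deltaPeriod 6 : ℝ) : ℂ) * Complex.I) ^ 2 =
        -(((deltaPeriod 5 / deltaPeriod 6) ^ 2 : ℝ) : ℂ) := by
      push_cast; rw [mul_pow, Complex.I_sq]; ring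
    have h3 : (((deltaPeriod 5 / deltaPeriod 6) ^ 2 : ℝ) : ℂ) = ((-q : ℚ) : ℂ) := by
      rw [h2] at hq
      have := congrArg Neg.neg hq
      simp only [neg_neg] at this
      rw [this]; push_cast; ring
    exact_mod_cast h3

end Summit.HodgeConjecture.HodgeConjecture.Cruxes.DeltaPeriodRatioIrrational.Strategist

end
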